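import Summits.RiemannHypothesis.RiemannHypothesis.Theorems.OddSectorOddArchAnchorFold
import Summits.RiemannHypothesis.RiemannHypothesis.Theorems.OddSectorOddArchAnchorSmoothFold
import Summits.RiemannHypothesis.RiemannHypothesis.Theorems.OddSectorOddArchAnchorMinimizer
import Summits.RiemannHypothesis.RiemannHypothesis.Theorems.WeilGroundStateMarkovPartPositiveGroundStateDensity
import Summits.RiemannHypothesis.RiemannHypothesis.Theses.OddSector

/-!
# Route OddSector, item `OddArchAnchor` (stmt-RiemannHypothesis-17781): proof

`Summit.RiemannHypothesis.RiemannHypothesis.Theses.OddSector.OddArchAnchor` — THE PRIME-FREE ANCHOR: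
for the archimedean part `Q₀(g) = Re W_∞(g ⋆ g̃)` of Weil's quadratic functional alone, every
window `a > 0` carries an ODD BOTTOM STATE that is real and `≥ 0` a.e. on the right half-window
`(0, a)`: there are `u ∈ L²` and an `L²`-normalised sequence of smooth odd window tests `gₙ`,
`Q₀`-minimising in the odd sector, with `gₙ → u` in `L²` and `Im u = 0`, `Re u ≥ 0` on `(0, a)`.

## Proof

1. `Q₀(g) = ∫₀^∞ ρ(t) D_t(g) dt − c₀‖g‖₂²` is a pure-jump Dirichlet form up to a constant
   (`weilArchTerm_weilConv_weilReflect_re`, Bombieri's archimedean term through increments), so on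
   the odd unit sphere it is bounded below; a minimising sequence exists and, `Re Q` being bounded
   along it, the Connes–Consani–Moscovici compactness yields an `L²`-convergent odd minimising
   sequence `gₙ → u` (`exists_oddArchMinimizingSeq_tendsto`).
2. FOLDING. Replace each `gₙ` by a smooth odd fold `hₙ` (`exists_smooth_fold`): on `x > 0`,
   `hₙ = Ψ_{ηₙ} ∘ gₙ` with `Ψ_η` radial, `1`-Lipschitz, vanishing near `0`, `ηₙ → 0`; so
   `|hₙ(s) − hₙ(x)| ≤ |gₙ(s) − gₙ(x)|`, `|hₙ(x)| ≤ |gₙ(x)|` on the half-line and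
   `|hₙ − sign·|gₙ|| ≤ 2ηₙ`. By the FOLDED-KERNEL INEQUALITY
   (`setIntegral_weilArchDensity_mul_weilIncrement_fold_le`: for odd functions the archimedean
   energy lives on `x, s > 0` with same-side kernel `ρ(|s−x|) ≥` opposite-side kernel `ρ(x+s)`,
   `ρ` decreasing) the energy of `hₙ` is at most that of `gₙ`.
3. `hₙ → v := sign · |u|` in `L²` (the fold is an `L²`-contraction and `2ηₙ → 0`), `‖hₙ‖₂ → 1`,
   and the renormalised `fₙ = hₙ/‖hₙ‖₂` are admissible odd window tests with
   `inf Q₀ ≤ Q₀(fₙ) ≤ (energy of gₙ)/‖hₙ‖₂² − c₀ → inf Q₀`: an odd minimising sequence converging to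
   `v`, which is real and `≥ 0` on `(0, ∞)`.

This is the antisymmetric analogue of the Beurling–Deny/Perron–Frobenius positivity of ground states
of Dirichlet forms (Bañuelos–Kulczycki 2004, Thm 4.3, for the Cauchy process on an interval), for
the logarithmic-order archimedean kernel of the explicit formula; no uniqueness is claimed.

## References

* E. Bombieri, Rend. Mat. Acc. Lincei (9) 11 (2000), Thm 2 and §4.
* R. Bañuelos, T. Kulczycki, J. Funct. Anal. 211 (2004), Thm 4.3.
* H. Chen, T. Weth, *The Dirichlet problem for the logarithmic Laplacian*, Comm. PDE 44 (2019).
* A. Connes, C. Consani, H. Moscovici, arXiv:2511.22755, Thm 3.6.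
-/

-- `Summit.RiemannHypothesis.RiemannHypothesis.…` repeats the summit name by design (D-0017 layout).
set_option linter.dupNamespace false

noncomputable section

open MeasureTheory Set Filter
open scoped Topology ENNReal

namespace Summit.RiemannHypothesis.RiemannHypothesis.Theorems

open Literature.NumberTheory.LFunctions
open Summit.RiemannHypothesis.RiemannHypothesis.Theorems.WeilGroundStateMarkovPart
open Summit.RiemannHypothesis.RiemannHypothesis.Theorems.OddArchAnchor
open Literature.NumberTheory.LFunctions.ConnesVanSuijlekom (tendsto_integral_norm_sq)

/-- **`OddArchAnchor` in the vocabulary of `Literature.NumberTheory.LFunctions.WeilExplicit`**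
(definitionally the route statement): for every window `a > 0` there are `u ∈ L²` and an
`L²`-normalised sequence of smooth odd window tests `gₙ`, minimising for
`Q₀(g) = Re weilArchTerm (g ⋆ g̃)` in the odd sector, with `∫ |gₙ − u|² → 0` and `Im u = 0`,
`Re u ≥ 0` a.e. on `(0, a)`. See the module docstring for the proof. -/
theorem oddArchAnchor_lit :
    ∀ a : ℝ, 0 < a → ∃ u : ℝ → ℂ, (MemLp u 2 ∧ ∃ g : ℕ → ℝ → ℂ,
      (∀ n, IsWeilTest (g n) ∧ tsupport (g n) ⊆ Icc (-a) a ∧ (∀ t, g n (-t) = -g n t) ∧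
        ∫ t, ‖g n t‖ ^ 2 = (1 : ℝ)) ∧
      (∀ h : ℝ → ℂ, IsWeilTest h → tsupport h ⊆ Icc (-a) a → (∀ t, h (-t) = -h t) →
        ∫ t, ‖h t‖ ^ 2 = (1 : ℝ) → ∀ δ : ℝ, 0 < δ → ∀ᶠ n in atTop,
          (weilArchTerm (weilConv (g n) (weilReflect (g n)))).re ≤
            (weilArchTerm (weilConv h (weilReflect h))).re + δ) ∧
      Tendsto (fun n ↦ ∫ t, ‖g n t - u t‖ ^ 2) atTop (𝓝 0)) ∧
      (∀ᵐ t : ℝ, t ∈ Ioo 0 a → (u t).im = 0 ∧ 0 ≤ (u t).re) := by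
  intro a ha
  -- notation: the constant `c₀`, the energy `E`, the value set `S` and its infimum `I`
  set c₀ : ℝ := 2 * (∫ t in Ioi (0 : ℝ), (Real.exp (t / 2) - 1) / (2 * Real.sinh t)) +
    (Real.log (4 * Real.pi) + Real.eulerMascheroniConstant) with hc₀
  set E : (ℝ → ℂ) → ℝ := fun f ↦ ∫ t in Ioi (0 : ℝ), weilArchDensity t * weilIncrement f t
    with hEdef
  have hQE : ∀ f : ℝ → ℂ, IsWeilTest f → ∫ x, ‖f x‖ ^ 2 = (1 : ℝ) →
      (weilArchTerm (weilConv f (weilReflect f))).re = E f - c₀ := fun f hf hn ↦ by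
    rw [weilArchTerm_weilConv_weilReflect_re hf, hn, mul_one]
  set S : Set ℝ := {x : ℝ | ∃ f : ℝ → ℂ, IsWeilTest f ∧ tsupport f ⊆ Icc (-a) a ∧
    (∀ t, f (-t) = -f t) ∧ ∫ t, ‖f t‖ ^ 2 = (1 : ℝ) ∧
    x = (weilArchTerm (weilConv f (weilReflect f))).re} with hS
  set I : ℝ := sInf S with hI
  have hIle : ∀ f : ℝ → ℂ, IsWeilTest f → tsupport f ⊆ Icc (-a) a → (∀ t, f (-t) = -f t) →
      ∫ t, ‖f t‖ ^ 2 = (1 : ℝ) → I ≤ (weilArchTerm (weilConv f (weilReflect f))).re :=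
    fun f hf hs ho hn ↦ csInf_le (oddArchSet_bddBelow a) ⟨f, hf, hs, ho, hn, rfl⟩
  -- (1) an `L²`-convergent odd minimising sequence
  obtain ⟨g, u, hg, hQ, hu, hlim⟩ := exists_oddArchMinimizingSeq_tendsto ha
  have hgm : ∀ n, MemLp (g n) 2 := fun n ↦ (hg n).1.memLp_two
  have hun : ∫ x, ‖u x‖ ^ 2 = 1 := by
    have h1 := tendsto_integral_norm_sq hu hgm hlim
    simp only [(hg _).2.2.2] at h1
    exact (tendsto_nhds_unique tendsto_const_nhds h1).symm
  have hEg : Tendsto (fun n ↦ E (g n)) atTop (𝓝 (I + c₀)) := by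
    have e : (fun n ↦ E (g n)) =
        fun n ↦ (weilArchTerm (weilConv (g n) (weilReflect (g n)))).re + c₀ := by
      funext n
      rw [hQE (g n) (hg n).1 (hg n).2.2.2]
      ring
    rw [e]
    exact hQ.add tendsto_const_nhds
  -- (2) the smooth folds
  set η : ℕ → ℝ := fun n ↦ 1 / ((n : ℝ) + 1) with hη
  have hηpos : ∀ n, 0 < η n := fun n ↦ by positivity
  have hη0 : Tendsto η atTop (𝓝 0) := tendsto_one_div_add_atTop_nhds_zero_nat
  have hfold := fun n ↦ exists_smooth_fold (hg n).1 (hg n).2.2.1 (hηpos n)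
  choose h hh hho hhs hhd hhn hhc using hfold
  have hhsupp : ∀ n, tsupport (h n) ⊆ Icc (-a) a := fun n ↦ (hhs n).trans (hg n).2.1
  have hhm : ∀ n, MemLp (h n) 2 := fun n ↦ (hh n).memLp_two
  have hEh : ∀ n, E (h n) ≤ E (g n) := fun n ↦
    setIntegral_weilArchDensity_mul_weilIncrement_fold_le (hg n).1 (hh n) (hg n).2.2.1 (hho n)
      (hhd n) (hhn n)
  -- the limit: the antisymmetric fold of `u`
  set v : ℝ → ℂ := fun x ↦ (((Real.sign x * ‖u x‖ : ℝ)) : ℂ) with hv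
  have hvm : MemLp v 2 := memLp_signFold hu
  have hvn : ∫ x, ‖v x‖ ^ 2 = 1 := by
    rw [← hun]
    exact integral_norm_sq_signFold u
  -- (3) `h n → v` in `L²`
  have hL2 : Tendsto (fun n ↦ ∫ x, ‖h n x - v x‖ ^ 2) atTop (𝓝 0) := by
    have hb : ∀ n, ∫ x, ‖h n x - v x‖ ^ 2 ≤
        2 * ((2 * η n) ^ 2 * (2 * a)) + 2 * ∫ x, ‖g n x - u x‖ ^ 2 := by
      intro n
      set F : ℝ → ℂ := fun x ↦ (((Real.sign x * ‖g n x‖ : ℝ)) : ℂ) with hF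
      have hFm : MemLp F 2 := memLp_signFold (hgm n)
      have h1 : ∫ x, ‖h n x - F x‖ ^ 2 ≤ (2 * η n) ^ 2 * (2 * a) := by
        refine integral_norm_sq_le_of_window ha.le (fun x ↦ hhc n x) (fun x hx ↦ ?_)
        have hx1 : h n x = 0 := image_eq_zero_of_notMem_tsupport fun h' ↦ hx (hhsupp n h')
        have hx2 : g n x = 0 := image_eq_zero_of_notMem_tsupport fun h' ↦ hx ((hg n).2.1 h')
        simp only [hF, hx1, hx2, norm_zero, mul_zero, Complex.ofReal_zero, sub_zero]
      have h2 : ∫ x, ‖F x - v x‖ ^ 2 ≤ ∫ x, ‖g n x - u x‖ ^ 2 := by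
        have hm : MemLp (fun x ↦ g n x - u x) 2 := (hgm n).sub hu
        refine integral_mono_of_nonneg (Eventually.of_forall fun x ↦ by positivity)
          ((memLp_two_iff_integrable_sq_norm hm.1).1 hm) (Eventually.of_forall fun x ↦ ?_)
        exact pow_le_pow_left₀ (norm_nonneg _) (norm_signFold_sub_le (g n) u x) 2
      have h3 := integral_norm_sq_add_le ((hhm n).sub hFm) (hFm.sub hvm)
      have e3 : (fun x ↦ ‖(h n - F) x + (F - v) x‖ ^ 2) = fun x ↦ ‖h n x - v x‖ ^ 2 := by
        funext x
        simp only [Pi.sub_apply, sub_add_sub_cancel]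
      rw [e3] at h3
      simp only [Pi.sub_apply] at h3
      linarith
    refine squeeze_zero (fun n ↦ integral_nonneg fun _ ↦ by positivity) hb ?_
    have h4 : Tendsto (fun n ↦ 2 * ((2 * η n) ^ 2 * (2 * a)) + 2 * ∫ x, ‖g n x - u x‖ ^ 2)
        atTop (𝓝 (2 * ((2 * 0) ^ 2 * (2 * a)) + 2 * 0)) :=
      ((((hη0.const_mul 2).pow 2).mul_const _).const_mul 2).add (hlim.const_mul 2)
    simpa using h4
  -- (4) the norms of the folds tend to `1`; shift the index so that they are `≥ 1/2`
  have hN : Tendsto (fun n ↦ ∫ x, ‖h n x‖ ^ 2) atTop (𝓝 1) := by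
    have := tendsto_integral_norm_sq hvm hhm hL2
    rwa [hvn] at this
  obtain ⟨n₀, hn₀⟩ : ∃ n₀, ∀ n ≥ n₀, (1 / 2 : ℝ) ≤ ∫ x, ‖h n x‖ ^ 2 :=
    eventually_atTop.1 (hN.eventually (Ici_mem_nhds (by norm_num : (1 / 2 : ℝ) < 1)))
  set N : ℕ → ℝ := fun n ↦ ∫ x, ‖h (n + n₀) x‖ ^ 2 with hNdef
  have hNpos : ∀ n, 0 < N n := fun n ↦
    lt_of_lt_of_le (by norm_num) (hn₀ (n + n₀) (Nat.le_add_left _ _))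
  have hNlim : Tendsto N atTop (𝓝 1) := hN.comp (tendsto_add_atTop_nat n₀)
  -- (5) the renormalised sequence
  set c : ℕ → ℝ := fun n ↦ (Real.sqrt (N n))⁻¹ with hcdef
  have hcpos : ∀ n, 0 < c n := fun n ↦ inv_pos.2 (Real.sqrt_pos.2 (hNpos n))
  have hc2 : ∀ n, ‖(c n : ℂ)‖ ^ 2 = (N n)⁻¹ := fun n ↦ by
    rw [Complex.norm_real, Real.norm_of_nonneg (hcpos n).le, hcdef, inv_pow,
      Real.sq_sqrt (hNpos n).le]
  have hc1 : Tendsto c atTop (𝓝 1) := by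
    have h1 := (hNlim.sqrt).inv₀ (by simp)
    simpa using h1
  set f : ℕ → ℝ → ℂ := fun n x ↦ (c n : ℂ) * h (n + n₀) x with hfdef
  have hft : ∀ n, IsWeilTest (f n) := fun n ↦ (hh _).const_mul _
  have hfs : ∀ n, tsupport (f n) ⊆ Icc (-a) a := fun n ↦
    tsupport_mul_subset_right.trans (hhsupp _)
  have hfo : ∀ n t, f n (-t) = -f n t := fun n t ↦ by simp only [hfdef, hho, mul_neg]
  have hfn : ∀ n, ∫ x, ‖f n x‖ ^ 2 = 1 := by
    intro n
    have e : (fun x ↦ ‖f n x‖ ^ 2) = fun x ↦ ‖(c n : ℂ)‖ ^ 2 * ‖h (n + n₀) x‖ ^ 2 := by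
      funext x
      simp only [hfdef, norm_mul, mul_pow]
    rw [e, integral_const_mul, hc2]
    exact inv_mul_cancel₀ (hNpos n).ne'
  -- `Q₀(f n) → I`
  have hQf_le : ∀ n, (weilArchTerm (weilConv (f n) (weilReflect (f n)))).re ≤
      (N n)⁻¹ * E (g (n + n₀)) - c₀ := fun n ↦ by
    rw [hQE (f n) (hft n) (hfn n)]
    have e : E (f n) = (N n)⁻¹ * E (h (n + n₀)) := by
      simp only [hEdef, hfdef]
      rw [archEnergy_const_mul, hc2]
    rw [e]
    linarith [mul_le_mul_of_nonneg_left (hEh (n + n₀)) (inv_nonneg.2 (hNpos n).le)]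
  have hQf_ge : ∀ n, I ≤ (weilArchTerm (weilConv (f n) (weilReflect (f n)))).re := fun n ↦
    hIle _ (hft n) (hfs n) (hfo n) (hfn n)
  have hup : Tendsto (fun n ↦ (N n)⁻¹ * E (g (n + n₀)) - c₀) atTop (𝓝 I) := by
    have h1 : Tendsto (fun n ↦ (N n)⁻¹) atTop (𝓝 1) := by simpa using hNlim.inv₀ one_ne_zero
    have h2 := ((h1.mul (hEg.comp (tendsto_add_atTop_nat n₀))).sub_const c₀)
    have e : (1 : ℝ) * (I + c₀) - c₀ = I := by ring
    rw [e] at h2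
    exact h2
  have hQf : Tendsto (fun n ↦ (weilArchTerm (weilConv (f n) (weilReflect (f n)))).re) atTop
      (𝓝 I) :=
    tendsto_of_tendsto_of_tendsto_of_le_of_le tendsto_const_nhds hup hQf_ge hQf_le
  -- `f n → v` in `L²`
  have hfL2 : Tendsto (fun n ↦ ∫ x, ‖f n x - v x‖ ^ 2) atTop (𝓝 0) := by
    have hb : ∀ n, ∫ x, ‖f n x - v x‖ ^ 2 ≤
        2 * ((c n - 1) ^ 2 * N n) + 2 * ∫ x, ‖h (n + n₀) x - v x‖ ^ 2 := by
      intro n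
      have hA : MemLp (fun x ↦ (((c n - 1 : ℝ)) : ℂ) * h (n + n₀) x) 2 := (hhm _).const_mul _
      have hB : MemLp (fun x ↦ h (n + n₀) x - v x) 2 := (hhm _).sub hvm
      have h3 := integral_norm_sq_add_le hA hB
      have e3 : (fun x ↦ ‖(((c n - 1 : ℝ)) : ℂ) * h (n + n₀) x + (h (n + n₀) x - v x)‖ ^ 2) =
          fun x ↦ ‖f n x - v x‖ ^ 2 := by
        funext x
        simp only [hfdef]
        congr 2
        push_cast
        ring
      have e4 : ∫ x, ‖(((c n - 1 : ℝ)) : ℂ) * h (n + n₀) x‖ ^ 2 = (c n - 1) ^ 2 * N n := by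
        have : (fun x ↦ ‖(((c n - 1 : ℝ)) : ℂ) * h (n + n₀) x‖ ^ 2) =
            fun x ↦ (c n - 1) ^ 2 * ‖h (n + n₀) x‖ ^ 2 := by
          funext x
          rw [norm_mul, mul_pow, Complex.norm_real, Real.norm_eq_abs, sq_abs]
        rw [this, integral_const_mul]
      rw [e3, e4] at h3
      exact h3
    refine squeeze_zero (fun n ↦ integral_nonneg fun _ ↦ by positivity) hb ?_
    have h4 : Tendsto (fun n ↦ 2 * ((c n - 1) ^ 2 * N n) + 2 * ∫ x, ‖h (n + n₀) x - v x‖ ^ 2)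
        atTop (𝓝 (2 * ((1 - 1) ^ 2 * 1) + 2 * 0)) :=
      ((((hc1.sub_const 1).pow 2).mul hNlim).const_mul 2).add
        ((hL2.comp (tendsto_add_atTop_nat n₀)).const_mul 2)
    simpa using h4
  -- assemble
  refine ⟨v, ⟨hvm, f, fun n ↦ ⟨hft n, hfs n, hfo n, hfn n⟩, ?_, hfL2⟩, ?_⟩
  · intro k hk hks hko hkn δ hδ
    have hIk := hIle k hk hks hko hkn
    have hev : ∀ᶠ n in atTop, (weilArchTerm (weilConv (f n) (weilReflect (f n)))).re < I + δ :=
      (tendsto_order.1 hQf).2 _ (by linarith)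
    filter_upwards [hev] with n hn
    linarith
  · refine Eventually.of_forall fun t ht ↦ ⟨?_, ?_⟩
    · simp only [hv, Complex.ofReal_im]
    · simp only [hv, Complex.ofReal_re, Real.sign_of_pos ht.1, one_mul]
      exact norm_nonneg _

/-- **Item `OddArchAnchor` of route OddSector (stmt-RiemannHypothesis-17781)**: the prime-free
archimedean form `Q₀(g) = Re W_∞(g ⋆ g̃)` has, on every window `a > 0`, an odd bottom state that
is real and `≥ 0` a.e. on `(0, a)`. The route statement is definitionally the Literature form
`oddArchAnchor_lit`. -/
theorem oddArchAnchor_proof :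
    Summit.RiemannHypothesis.RiemannHypothesis.Theses.OddSector.OddArchAnchor :=
  oddArchAnchor_lit

end Summit.RiemannHypothesis.RiemannHypothesis.Theorems

end
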